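import Literature.NumberTheory.EllipticCurves.DegreeConjectureAbcSemistable
import Literature.NumberTheory.EllipticCurves.NewformPeterssonSizeProofs
import Literature.NumberTheory.EllipticCurves.SilvermanHeightCovolumeProofs
import HarnessLib

/-!
# Route TwistAmplification — crux `SomeWindowSaving` (stmt-ABC-1976),
  line `polynomial-degree-suffices`: stub `stub_zagierSilvermanBridgeSemistable`

The registered stub 2' of the line: the **Zagier–Petersson–Silverman bridge with an inert
exponent, semistable curves**. A POLYNOMIAL modular-degree bound `deg φ ≤ C · N^κ` (some `κ`) for
the semistable elliptic curves over `ℚ` in global minimal form gives WEAK GENERALIZED SZPIRO for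
all semistable integral models minimal at every place: `max(|Δ|, |c₄|³) ≤ C' · N^K` for some
absolute `K, C'`.

The proof is the first half of
`Literature.NumberTheory.EllipticCurves.abcLe_sixteen_of_semistableDegreeBound`
(`DegreeConjectureAbcSemistable.lean`) with `2 + δ ↦ κ` and the Silverman exponent `ε := 1`,
run POINTWISE (one curve, one datum ↦ one Szpiro inequality):

* `ZagierSilvermanBridge.le_of_covolume_estimates` — real-arithmetic core:
  `M ≤ A · covol^{-7}` and `κ₀ N^{-(1+2δ)} ≤ covol` give `M ≤ max(A,0) κ₀^{-7} N^{7(1+2δ)}`.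
* `ZagierSilvermanBridge.deg_le_of_le` — `deg ≤ C X N^κ`, `X ≤ Y`, `κ ≤ 2 + δ`, `N ≥ 1` give
  `deg ≤ max(C,1) Y N^{2+δ}` (the shape `covolume_ge_of_deg_le` consumes).
* `ZagierSilvermanBridge.pointwise` — for an integral model `W₀` whose base change `W/ℚ` is
  elliptic and globally minimal, and ANY parametrisation datum `D` of `W` at ANY level `N` with
  `deg ≤ C₁ c² N^{2+δ}`: Zagier's identity (`zagier_degree_formula_holds`, inside
  `covolume_ge_of_deg_le`) and the Petersson input `c₂ N^{1−δ} ≤ (f,f)` give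
  `covol(Λ_E) ≥ (4π²c₂/C₁) N^{−(1+2δ)}`; Silverman's covolume inequality at `ε = 1` gives
  `max(|Δ_W|, |c₄(W)|³) ≤ A covol^{−7}`; and `Δ_W = Δ_{W₀}`, `c₄(W) = c₄(W₀)` (`map_Δ`, `map_c₄`).
* `stub_zagierSilvermanBridgeSemistable` — the registered statement: choose
  `δ := max κ 3 − 2 ≥ 1` (so the Petersson input is the PROVED range `ε ≥ 1`,
  `murty_petersson_newform_lower_bound_of_one_le`), `C₁ := max C 1`, the Silverman constant of
  `silverman1986_discriminant_c4_covolume_holds 1`, and `c² ≥ 1` for the Manin constant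
  (`maninConstant_ne_zero_holds`); output `K := 7(1 + 2δ)`.
* `weakGenSzpiro_of_polyDegreeAll` — the same bridge for ALL curves, from the `deg ≤ C c² N^κ`
  form of a polynomial degree bound (corollary of the shared pointwise lemma).

Everything used is PROVED in the tree (no named-fact hypothesis): `covolume_ge_of_deg_le`,
`murty_petersson_newform_lower_bound_of_one_le`, `silverman1986_discriminant_c4_covolume_holds`,
`isGloballyMinimal_of_forall_isMinimalAt_int`, `conductorNorm_pos_holds`,
`ModularParametrizationData.maninConstant_ne_zero_holds`. Sources: Frey 1987/1997 (degree
conjecture ⟹ height conjecture), M. R. Murty 1999 Thm. 1, Pasten arXiv:1705.09251 §3,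
Silverman 1986 Cor. 2.3 with Prop. 1.1. Lands `--supports stmt-ABC-1976`.
-/

noncomputable section

open IsDedekindDomain WeierstrassCurve
open Literature.NumberTheory.EllipticCurves
open Literature.NumberTheory.EllipticCurves.ModularForms
open CongruenceSubgroup

-- `Summit.<Summit>.<Problem>` is the mandated summit-side namespace (CONVENTIONS §2); for the
-- single-conjunct summit `ABC` the two coincide, so the duplicate `ABC.ABC` is deliberate.
set_option linter.dupNamespace false

namespace Summit.ABC.ABC.Theorems

/-- **Real-arithmetic core of the bridge.** If `M ≤ A · covol^{−(6+1)}` and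
`κ₀ · N^{−(1+2δ)} ≤ covol` with `κ₀, N, covol > 0`, then
`M ≤ max(A, 0) · κ₀^{−(6+1)} · N^{(1+2δ)(6+1)}`. [folklore] -/
theorem ZagierSilvermanBridge.le_of_covolume_estimates {M A covol κ₀ N δ : ℝ} (hκ₀ : 0 < κ₀)
    (hN : 0 < N) (hcov : 0 < covol) (hM : M ≤ A * covol ^ (-(6 + 1 : ℝ)))
    (hlow : κ₀ * N ^ (-(1 + 2 * δ)) ≤ covol) :
    M ≤ max A 0 * κ₀ ^ (-(6 + 1 : ℝ)) * N ^ ((1 + 2 * δ) * (6 + 1)) := by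
  have hexp : (-(6 + 1 : ℝ)) ≤ 0 := by norm_num
  have hlow0 : 0 < κ₀ * N ^ (-(1 + 2 * δ)) := mul_pos hκ₀ (Real.rpow_pos_of_pos hN _)
  have h2 : covol ^ (-(6 + 1 : ℝ)) ≤ (κ₀ * N ^ (-(1 + 2 * δ))) ^ (-(6 + 1 : ℝ)) :=
    Real.rpow_le_rpow_of_nonpos hlow0 hlow hexp
  have h3 : (κ₀ * N ^ (-(1 + 2 * δ))) ^ (-(6 + 1 : ℝ)) =
      κ₀ ^ (-(6 + 1 : ℝ)) * N ^ ((1 + 2 * δ) * (6 + 1)) := by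
    rw [Real.mul_rpow hκ₀.le (Real.rpow_nonneg hN.le _), ← Real.rpow_mul hN.le]
    congr 1; ring
  have hA : A ≤ max A 0 := le_max_left _ _
  have hA0 : 0 ≤ max A 0 := le_max_right _ _
  have hce : 0 ≤ covol ^ (-(6 + 1 : ℝ)) := Real.rpow_nonneg hcov.le _
  calc M ≤ A * covol ^ (-(6 + 1 : ℝ)) := hM
    _ ≤ max A 0 * covol ^ (-(6 + 1 : ℝ)) := mul_le_mul_of_nonneg_right hA hce
    _ ≤ max A 0 * (κ₀ ^ (-(6 + 1 : ℝ)) * N ^ ((1 + 2 * δ) * (6 + 1))) :=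
        mul_le_mul_of_nonneg_left (h3 ▸ h2) hA0
    _ = _ := by ring

/-- **Degree bookkeeping.** `deg ≤ C · X · N^κ` with `0 ≤ X ≤ Y`, `κ ≤ 2 + δ` and `N ≥ 1` gives
`deg ≤ max(C, 1) · Y · N^{2+δ}`, the shape consumed by `covolume_ge_of_deg_le`. [folklore] -/
theorem ZagierSilvermanBridge.deg_le_of_le {deg C X Y N κ δ : ℝ} (hN : 1 ≤ N) (hX : 0 ≤ X)
    (hXY : X ≤ Y) (hκ : κ ≤ 2 + δ) (h : deg ≤ C * X * N ^ κ) :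
    deg ≤ max C 1 * Y * N ^ (2 + δ) := by
  have hN0 : 0 ≤ N := zero_le_one.trans hN
  have hC : 0 ≤ max C 1 := zero_le_one.trans (le_max_right _ _)
  calc deg ≤ C * X * N ^ κ := h
    _ = C * (X * N ^ κ) := by ring
    _ ≤ max C 1 * (X * N ^ κ) :=
        mul_le_mul_of_nonneg_right (le_max_left _ _) (mul_nonneg hX (Real.rpow_nonneg hN0 _))
    _ ≤ max C 1 * (Y * N ^ (2 + δ)) :=
        mul_le_mul_of_nonneg_left (mul_le_mul hXY (Real.rpow_le_rpow_of_exponent_le hN hκ)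
          (Real.rpow_nonneg hN0 _) (hX.trans hXY)) hC
    _ = _ := by ring

/-- `1 ≤ c²` in `ℝ` for a non-zero integer `c` (applied to the Manin constant). [folklore] -/
theorem ZagierSilvermanBridge.one_le_cast_sq {c : ℤ} (hc : c ≠ 0) : (1 : ℝ) ≤ (c : ℝ) ^ 2 := by
  have h : (1 : ℤ) ≤ c ^ 2 := (one_le_sq_iff_one_le_abs c).mpr (Int.one_le_abs hc)
  exact_mod_cast h

/-- **The Zagier–Petersson–Silverman bridge, pointwise** (Frey; Murty 1999 Thm. 1; Pasten
arXiv:1705.09251 §3; Silverman 1986 Cor. 2.3). Let `c₂ > 0` be a Petersson constant at exponent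
`1 − δ` (`c₂ N^{1−δ} ≤ (f,f)` for every newform of an elliptic curve) and `A` a Silverman
constant at `ε = 1` (`max(|Δ_W|,|c₄(W)|³) ≤ A covol(Λ)^{−7}` for globally minimal `W` and its
Néron lattice). Then for every integral model `W₀` whose base change `W/ℚ` is elliptic and globally
minimal, and every modular parametrisation datum `D` of `W` at a level `N` with
`deg ≤ C₁ c² N^{2+δ}`:
`max(|Δ_{W₀}|, |c₄(W₀)|³) ≤ max(A,0) · (4π²c₂/C₁)^{−7} · N^{7(1+2δ)}`.
Proof: `covolume_ge_of_deg_le` (Zagier's identity) gives `covol ≥ (4π²c₂/C₁) N^{−(1+2δ)}`,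
Silverman bounds `max(|Δ_W|,|c₄(W)|³)` by `A covol^{−7}`, and `Δ_W = Δ_{W₀}`, `c₄(W) = c₄(W₀)`.
[folklore] -/
theorem ZagierSilvermanBridge.pointwise {δ C₁ c₂ A : ℝ} (hC₁ : 0 < C₁) (hc₂ : 0 < c₂)
    (hP : ∀ (N : ℕ) [NeZero N] (W : WeierstrassCurve ℚ) [W.IsElliptic]
      (f : CuspForm (Gamma0 N) 2), IsNewformOf W f →
        c₂ * (N : ℝ) ^ (1 - δ) ≤ (peterssonProduct (Gamma0 N) 2 f f).re)
    (hA : ∀ (W : WeierstrassCurve ℚ) [W.IsElliptic] [W.IsGloballyMinimal] (L : PeriodPair),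
      IsNeronLatticeOf (W.baseChange ℂ) L →
        ((max |W.Δ| (|W.c₄| ^ 3) : ℚ) : ℝ) ≤ A * ZLattice.covolume L.lattice ^ (-(6 + 1 : ℝ)))
    (W₀ : WeierstrassCurve ℤ) [(W₀.baseChange ℚ).IsElliptic] [(W₀.baseChange ℚ).IsGloballyMinimal]
    {N : ℕ} [NeZero N] (D : ModularParametrizationData (W₀.baseChange ℚ) N)
    (hD : (D.deg : ℝ) ≤ C₁ * (D.c : ℝ) ^ 2 * (N : ℝ) ^ (2 + δ)) :
    ((max |W₀.Δ| (|W₀.c₄| ^ 3) : ℤ) : ℝ) ≤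
      max A 0 * (4 * Real.pi ^ 2 * c₂ / C₁) ^ (-(6 + 1 : ℝ)) *
        (N : ℝ) ^ ((1 + 2 * δ) * (6 + 1)) := by
  have hNpos : (0 : ℝ) < (N : ℝ) := by exact_mod_cast Nat.pos_of_ne_zero (NeZero.ne N)
  have hκ₀ : 0 < 4 * Real.pi ^ 2 * c₂ / C₁ := div_pos (by positivity) hC₁
  -- Zagier + degree bound + Petersson: the covolume of the Néron lattice from below
  have hPD := hP N (W₀.baseChange ℚ) D.f D.isNewformOf
  have hlow := covolume_ge_of_deg_le D hC₁ hD hPD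
  -- Silverman for the Néron lattice `D.L` of the minimal model `W₀ ⊗ ℚ`
  have hSW := hA (W₀.baseChange ℚ) D.L D.isNeronLattice
  have hcov : 0 < ZLattice.covolume D.L.lattice := ZLattice.covolume_pos _ _
  have hmain := ZagierSilvermanBridge.le_of_covolume_estimates hκ₀ hNpos hcov hSW hlow
  -- the invariants of `W₀ ⊗ ℚ` are those of `W₀`
  have hΔW : (W₀.baseChange ℚ).Δ = (W₀.Δ : ℚ) := by
    simp [WeierstrassCurve.baseChange, WeierstrassCurve.map_Δ]
  have hc₄W : (W₀.baseChange ℚ).c₄ = (W₀.c₄ : ℚ) := by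
    simp [WeierstrassCurve.baseChange, WeierstrassCurve.map_c₄]
  have e1 : ((max |W₀.Δ| (|W₀.c₄| ^ 3) : ℤ) : ℝ) =
      ((max |(W₀.baseChange ℚ).Δ| (|(W₀.baseChange ℚ).c₄| ^ 3) : ℚ) : ℝ) := by
    rw [hΔW, hc₄W]; norm_cast
  rw [e1]
  exact hmain

/-- **STUB 2' of line `polynomial-degree-suffices` (crux `SomeWindowSaving`, stmt-ABC-1976):
the Zagier–Petersson–Silverman bridge with an inert exponent, semistable curves.** A polynomial
modular-degree bound `deg φ ≤ C · N^κ` for the semistable elliptic curves over `ℚ` in global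
minimal form (with a parametrisation datum at level `N = N_E`) implies weak generalized Szpiro
for every semistable integral model minimal at all places:
`max(|Δ|, |c₄|³) ≤ C' · N^K` with `K = 7(1 + 2δ)`, `δ = max κ 3 − 2`.
Given `W₀`, put `W := W₀ ⊗ ℚ` (globally minimal by `isGloballyMinimal_of_forall_isMinimalAt_int`,
`N_E > 0` by `conductorNorm_pos_holds`), take the datum `D` of the hypothesis; since the Manin
constant is a non-zero integer (`maninConstant_ne_zero_holds`), `deg ≤ max(C,1) c² N^{2+δ}`;
the Petersson input at exponent `1 − δ ≤ 0` is the proved range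
`murty_petersson_newform_lower_bound_of_one_le`, the Silverman input is
`silverman1986_discriminant_c4_covolume_holds 1`; conclude by `ZagierSilvermanBridge.pointwise`.
(Frey 1997 Cor. 3.1; Murty 1999 Thm. 1; Pasten arXiv:1705.09251 §3; Silverman 1986 Cor. 2.3.)
[folklore] -/
theorem stub_zagierSilvermanBridgeSemistable :
    (∃ κ C : ℝ, ∀ (W : WeierstrassCurve ℚ) [W.IsElliptic] [W.IsGloballyMinimal]
      [NeZero (W.conductorNorm ℤ)], W.IsSemistable ℤ →
        ∃ D : ModularParametrizationData W (W.conductorNorm ℤ),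
          (D.modularDegree : ℝ) ≤ C * (W.conductorNorm ℤ : ℝ) ^ κ) →
    ∃ K C : ℝ, ∀ W₀ : WeierstrassCurve ℤ, (W₀.baseChange ℚ).IsElliptic →
      (∀ v : HeightOneSpectrum ℤ, (W₀.baseChange ℚ).IsMinimalAt v) →
        (W₀.baseChange ℚ).IsSemistable ℤ →
          ((max |W₀.Δ| (|W₀.c₄| ^ 3) : ℤ) : ℝ) ≤
            C * (((W₀.baseChange ℚ).conductorNorm ℤ : ℕ) : ℝ) ^ K := by
  rintro ⟨κ, C, hdeg⟩
  -- uniform constants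
  obtain ⟨δ, hδ1, hκδ⟩ : ∃ δ : ℝ, 1 ≤ δ ∧ κ ≤ 2 + δ :=
    ⟨max κ 3 - 2, by have := le_max_right κ 3; linarith, by have := le_max_left κ 3; linarith⟩
  have hC₁ : (0 : ℝ) < max C 1 := one_pos.trans_le (le_max_right _ _)
  obtain ⟨c₂, hc₂, hP⟩ := murty_petersson_newform_lower_bound_of_one_le hδ1
  obtain ⟨A, hA⟩ := silverman1986_discriminant_c4_covolume_holds 1 one_pos
  refine ⟨(1 + 2 * δ) * (6 + 1), max A 0 * (4 * Real.pi ^ 2 * c₂ / max C 1) ^ (-(6 + 1 : ℝ)),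
    fun W₀ hE hmin hss ↦ ?_⟩
  -- the curve: instances, the datum, the degree bound in the shape `deg ≤ C₁ c² N^{2+δ}`
  haveI : (W₀.baseChange ℚ).IsGloballyMinimal :=
    isGloballyMinimal_of_forall_isMinimalAt_int _ hmin
  have hN0 : 0 < (W₀.baseChange ℚ).conductorNorm ℤ := conductorNorm_pos_holds _
  haveI : NeZero ((W₀.baseChange ℚ).conductorNorm ℤ) := ⟨hN0.ne'⟩
  obtain ⟨D, hD⟩ := hdeg (W₀.baseChange ℚ) hss
  have hN1 : (1 : ℝ) ≤ (((W₀.baseChange ℚ).conductorNorm ℤ : ℕ) : ℝ) := by exact_mod_cast hN0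
  have hc0 : D.maninConstant ≠ 0 := D.maninConstant_ne_zero_holds
  have hc1 : (1 : ℝ) ≤ (D.c : ℝ) ^ 2 := ZagierSilvermanBridge.one_le_cast_sq hc0
  have hD1 : (D.deg : ℝ) ≤ C * 1 * (((W₀.baseChange ℚ).conductorNorm ℤ : ℕ) : ℝ) ^ κ := by
    rw [mul_one]; exact hD
  have hD' := ZagierSilvermanBridge.deg_le_of_le hN1 zero_le_one hc1 hκδ hD1
  exact ZagierSilvermanBridge.pointwise hC₁ hc₂ hP hA W₀ D hD'

/-- **The bridge for all curves** (corollary of `ZagierSilvermanBridge.pointwise`): a polynomial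
modular-degree bound in the form `deg ≤ C · c² · N^κ` for EVERY elliptic curve over `ℚ` in global
minimal form (with a parametrisation datum at level `N_E`) gives weak generalized Szpiro
`max(|Δ|, |c₄|³) ≤ C' · N^K` for every integral model minimal at all places. Same proof as
`stub_zagierSilvermanBridgeSemistable` without the semistability thread (Frey 1997 Cor. 3.1;
Murty 1999 Thm. 1; Pasten arXiv:1705.09251 §3; Silverman 1986 Cor. 2.3). [folklore] -/
theorem weakGenSzpiro_of_polyDegreeAll :
    (∃ κ C : ℝ, ∀ (W : WeierstrassCurve ℚ) [W.IsElliptic] [W.IsGloballyMinimal]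
      [NeZero (W.conductorNorm ℤ)], ∃ D : ModularParametrizationData W (W.conductorNorm ℤ),
        (D.deg : ℝ) ≤ C * (D.c : ℝ) ^ 2 * ((W.conductorNorm ℤ : ℕ) : ℝ) ^ κ) →
    ∃ K C : ℝ, ∀ W₀ : WeierstrassCurve ℤ, (W₀.baseChange ℚ).IsElliptic →
      (∀ v : HeightOneSpectrum ℤ, (W₀.baseChange ℚ).IsMinimalAt v) →
        ((max |W₀.Δ| (|W₀.c₄| ^ 3) : ℤ) : ℝ) ≤
          C * (((W₀.baseChange ℚ).conductorNorm ℤ : ℕ) : ℝ) ^ K := by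
  rintro ⟨κ, C, hdeg⟩
  obtain ⟨δ, hδ1, hκδ⟩ : ∃ δ : ℝ, 1 ≤ δ ∧ κ ≤ 2 + δ :=
    ⟨max κ 3 - 2, by have := le_max_right κ 3; linarith, by have := le_max_left κ 3; linarith⟩
  have hC₁ : (0 : ℝ) < max C 1 := one_pos.trans_le (le_max_right _ _)
  obtain ⟨c₂, hc₂, hP⟩ := murty_petersson_newform_lower_bound_of_one_le hδ1
  obtain ⟨A, hA⟩ := silverman1986_discriminant_c4_covolume_holds 1 one_pos
  refine ⟨(1 + 2 * δ) * (6 + 1), max A 0 * (4 * Real.pi ^ 2 * c₂ / max C 1) ^ (-(6 + 1 : ℝ)),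
    fun W₀ hE hmin ↦ ?_⟩
  haveI : (W₀.baseChange ℚ).IsGloballyMinimal :=
    isGloballyMinimal_of_forall_isMinimalAt_int _ hmin
  have hN0 : 0 < (W₀.baseChange ℚ).conductorNorm ℤ := conductorNorm_pos_holds _
  haveI : NeZero ((W₀.baseChange ℚ).conductorNorm ℤ) := ⟨hN0.ne'⟩
  obtain ⟨D, hD⟩ := hdeg (W₀.baseChange ℚ)
  have hN1 : (1 : ℝ) ≤ (((W₀.baseChange ℚ).conductorNorm ℤ : ℕ) : ℝ) := by exact_mod_cast hN0
  have hD' := ZagierSilvermanBridge.deg_le_of_le hN1 (sq_nonneg _) le_rfl hκδ hD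
  exact ZagierSilvermanBridge.pointwise hC₁ hc₂ hP hA W₀ D hD'

end Summit.ABC.ABC.Theorems

end
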